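import Summits.SmoothPoincare4.SmoothPoincare4.Theorems.SullivanDualWitnessChargeV16AssemblyFacts
import Summits.SmoothPoincare4.SmoothPoincare4.Theorems.SullivanDualWitnessChargeReductionV8
import Literature.Geometry.Symplectic.JHolomorphicLimitEmbeddedProofs
import Literature.Geometry.Symplectic.JHolomorphicIsolatedIntersectionPersists
import Literature.Topology.FourManifolds.HomotopyS4OrientableProofs

/-!
# Crux `WitnessCharge`, reduction v16: the crux from three named facts of `J`-curve theory (lead c8)

`helper_witnessCharge_of_symplecticCapFacts`:

  `hls_localFoliation_embeddedSphere_trivialNormal → adjunction_embedded_of_somewhereInjective_sphere →`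
  `jHolomorphic_immersed_of_limitEmbedded_punctured → Theses.SullivanDual.WitnessCharge`

— the crux `WitnessCharge` (stmt-SmoothPoincare4-7824) follows from the Hofer–Lizan–Sikorav local
foliation (crux `LocalFoliationEmbeddedSpheres`, stmt-16778), adjunction for somewhere injective
spheres (crux `AdjunctionEmbeddedSpheres`, stmt-16775) and McDuff's no-cusp theorem F5 (reduced in
Literature to Wendl 2020 Thm B.23). Composition of the v16 assembly `helper_localFamilyUniv_of_facts`
(A′) with ReductionV7 `WitnessCharge_of_localFamilyUniv_of_limitEmbedded : A′ → D1b → WitnessCharge`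
and `substub_limitEmbedded_of_mcduff` on L1b = F4 ∧ F5
(`jHolomorphicLimitOfEmbedded_isEmbedded_of_persist_of_noCusp`, F4 a Literature theorem). This
supersedes v10 (`…_of_pencilLocalFamily_of_representationFormula`: crux 16772 + hX).
-/

noncomputable section

set_option linter.dupNamespace false

open scoped Manifold ContDiff Topology
open Set Filter Literature.Geometry.Symplectic Literature.Topology.FourManifolds

namespace Summit.SmoothPoincare4.SmoothPoincare4.Theorems.WitnessCharge.PencilIncompleteness

/-- **The crux `WitnessCharge` from the three named facts** (HLS local foliation, adjunction, McDuff
no-cusp). -/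
theorem helper_witnessCharge_of_symplecticCapFacts :
    Literature.Geometry.Symplectic.hls_localFoliation_embeddedSphere_trivialNormal →
    Literature.Geometry.Symplectic.adjunction_embedded_of_somewhereInjective_sphere →
    Literature.Geometry.Symplectic.jHolomorphic_immersed_of_limitEmbedded_punctured →
    Summit.SmoothPoincare4.SmoothPoincare4.Theses.SullivanDual.WitnessCharge :=
  fun hls hadj hF5 =>
    WitnessCharge_of_localFamilyUniv_of_limitEmbedded (helper_localFamilyUniv_of_facts hls hadj)
      (substub_limitEmbedded_of_mcduff
        (Literature.Geometry.Symplectic.jHolomorphicLimitOfEmbedded_isEmbedded_of_persist_of_noCusp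
          Literature.Geometry.Symplectic.jHolomorphic_isolatedIntersection_persists_holds hF5))

/-- **Crux `PencilLocalFamily` (stmt-SmoothPoincare4-16772) from the two SymplecticCap facts**: the
local family of the pencil with universality, for ANY compact smooth 4-manifold homotopy equivalent to
`S⁴` — such an `M` is orientable (`isOrientable_of_homotopyEquiv_sphere_four_holds`, Lee Thm 15.43),
hence a `HomotopySphere 4`, and the route's inlined member predicate is `IsPencilMember` by `rfl`; so
this is `helper_localFamilyUniv_of_facts` verbatim. Conditional result for the sibling crux:
16772 ⇐ 16778 ∧ 16775. -/
theorem helper_pencilLocalFamily_of_symplecticCapFacts :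
    Literature.Geometry.Symplectic.hls_localFoliation_embeddedSphere_trivialNormal →
    Literature.Geometry.Symplectic.adjunction_embedded_of_somewhereInjective_sphere →
    Summit.SmoothPoincare4.SmoothPoincare4.Theses.SullivanDual.PencilLocalFamily := by
  intro hls hadj M _ _ _ _ _ _ hhe p J ε' hε' hball hJ2 hJsm hJstd
  obtain ⟨e⟩ := hhe
  obtain ⟨o⟩ := isOrientable_of_homotopyEquiv_sphere_four_holds M e
  exact helper_localFamilyUniv_of_facts hls hadj ⟨M, o, ⟨e⟩⟩ p J ε' hε' hball hJ2 hJsm hJstd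

end Summit.SmoothPoincare4.SmoothPoincare4.Theorems.WitnessCharge.PencilIncompleteness
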